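import Summits.AtomisticToContinuum.HydrodynamicLimit.Theses.OneFlightGossipEngine
import Summits.AtomisticToContinuum.HydrodynamicLimit.Theorems.EnergyCurrentTails.Negative.FocusingLaws
import Summits.AtomisticToContinuum.HydrodynamicLimit.Theorems.EnergyCurrentTails.Negative.CubicTailExpMoment
import Summits.AtomisticToContinuum.HydrodynamicLimit.Theorems.OneFlightGossipEngineClampedTransferDockSeet

/-!
# Disproof workfile for the crux `SuperExponentialEnergyTails` (SEET, stmt-AtomisticToContinuum-17701)

Route decl: `Summit.AtomisticToContinuum.HydrodynamicLimit.Theses.OneFlightGossipEngine.SuperExponentialEnergyTails`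
(rank 7 of route OneFlightGossipEngine, rev 32; byte-identical with the registered stub
`Theorems.ClampedTransferDockCubicRate.SuperExponentialEnergyTails` of the dock line `Sketch`).
Standing adversary: refuter-cdisprove-stmt-AtomisticToContinuum-17701-0 (cycle 1, 2026-08-17).
Prose lives in docstrings; the file is sorry-free (`lean check` rc 0, 0 warnings).

## The statement, read back (probe `W.lean`, rc 0)

For all continuous profiles `a₀ > 0`, `θ₀ > 0`, `u₀` on `𝕋³` there is `σ₀ > 0` such that for all
`0 < σ < σ₀`, every `T`, every classical hs-Euler solution `(ρ, u, θ)` on `[0, T)` and every family of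
hard-sphere flows `Φ N` (`N + 1` spheres of diameter `σ(N+1)^{-1/3}`): IF the empirical fields of the
local Gibbs laws `λ_N = localGibbsLaw σ a₀ u₀ θ₀ N (Φ N)` converge in probability at `t = 0` to
`(ρ, ρu, E)(0)`, THEN for every `t ∈ [0, T)` and every RATE `c > 0` there is a level `K₀ > 0` such that
for all `K ≥ K₀` and `ε > 0`, eventually in `N` and uniformly in `s ∈ [0, t]`,
`E_{λ_N}[(N+1)⁻¹ ∑ᵢ 𝟙{K < |vᵢ(s)|} |vᵢ(s)|³] ≤ e^{-cK} + ε`  (`vᵢ(s) = ((Φ N).flow s z i).2`).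
Equivalently: `g_t(K) := limsup_N sup_{s ≤ t} E_{λ_N}[tail_K(s)]` decays FASTER THAN EVERY EXPONENTIAL.
It is the rate form of the sibling crux `EnergyCurrentTails` (ECT, stmt-9235: `g_t(K) → 0`); SEET ⇒ ECT
is landed (`ClampedTransferDockSeet.seet_imp_energyCurrentTails`).

Coercion / junk audit (all benign, as for ECT — see `Cruxes/EnergyCurrentTails/Disproof.lean`):
`∫⁻ ∘ ENNReal.ofReal` of a nonnegative real; `λ_N` is the flow-free `localGibbsMeasure`
(`localGibbsLaw_eq`), a probability measure for `σ ≤ 1/2` and the ZERO measure once the spheres cannot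
fit (then the conclusion is trivially true, never false); the flow is junk only off a Liouville-conull
invariant good set, `λ_N ≪` Liouville, hard-sphere flows EXIST (`HardSphereFlow.nonempty_torus_holds`,
`CollisionActivityTailsEquilibrium.flows_nonempty`) and agree a.e. (`HardSphereFlow.flow_eq_ae_holds`),
so the dependence on `Φ` is fictitious; quantifier order `∀ c ∃ K₀ ∀ K ∀ ε ∃ N₀ ∀ N ∀ s` is the intended
"level after rate, accuracy after level" order of the dock's D-shape ledger; `T ≤ 0` is vacuous; `t = 0`
gives `s = 0` only.  STRUCTURAL REMARK: the Euler data `(ρ, u, θ)` enter the conclusion ONLY through the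
horizon `t < T`, the LLN hypothesis enters nothing else — SEET is a pure a priori estimate on
`(profiles, σ, Φ, t)`; at CONSTANT profiles the horizon is unbounded (constant states are global
classical solutions), so SEET contains its all-time equilibrium rung — which is TRUE (§4).

## Findings (cycle 1) — NO KILL, no misstatement; 1 negative file LANDED, equilibrium rung PROVED

1. JUNK-MODEL / DEGENERATE ATTACKS fail (as for ECT): `HardSphereFlow.isTrajectory` pins free flight +
   elastic collisions; `N + 1 = 1` and `σ ≤ 0`-type junk regimes are free flight (velocities, hence
   the functional, constant in `s`; true by the `s = 0` rung); `σ` large ⇒ zero law ⇒ true; `t = 0` ⇒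
   the `s = 0` rung `ClampedTransferDockSeet.seet_time_zero` (TRUE for every profile, every `σ ≤ 1/2`,
   every `N`, no slack).
2. THE EQUILIBRIUM SECTOR IS CLOSED (checked, companion `EquilibriumRung.lean` in this crux directory,
   sorry-free, evidence on the item): for the homogeneous profile `(1, 0, θ̄)`, every `0 < σ < 1/2`,
   EVERY flow family and every rate `c`, `E tail_K(s) ≤ e^{-cK}` for all `K ≥ K₀(c, θ̄)`, ALL `N`, ALL
   `s ∈ ℝ` (`seet_homogeneous`: a.e. uniqueness of flows + invariance of the homogeneous law under the
   regularised Alexander flow + `seet_time_zero`); the crux's body verbatim at that profile holds with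
   `σ₀ = 1/2`, `N₀ = 0` (`seet_body_homogeneous`).  So a counterexample must be out of equilibrium AND
   pre-shock; the only data with unbounded horizon are harmless.
3. LOAD-BEARING HYPOTHESES (§2): (a) the RANDOMNESS of the data is load-bearing — the sure version over
   bounded-energy configurations is false (`seet_false_without_randomness`, from ECT's
   `energyCurrentTails_false_without_randomness`: one sphere of speed `√(N+1)`); (b) NOT load-bearing
   (paper + items 1–2): the Euler solution and the LLN tie (decoration but for the horizon), `σ < σ₀`
   (any `σ ≤ 1/2` is expected to do; `seet_of_highMomentumCutoff` already takes `σ₀ = 1/2`), `N₀` and the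
   slack `ε` at `s = 0` and at equilibrium, continuity of the profiles beyond boundedness (the LLN tie to
   a SMOOTH Euler datum forces `θ₀` to be a.e. equal to a bounded function anyway), `0 < a₀`, `0 < θ₀`
   (non-degeneracy guards: where they fail the one-body profile vanishes, `Real.rpow`/division junk, and
   the law only loses support).
4. NATURAL STRENGTHENINGS REFUTED (checked; §3 and the LANDED file
   `Theorems/SuperExponentialEnergyTails/Negative/GaussianRateFalse.lean`, p144828 ACCEPTED @ a6d705fdb969):
   (c1) TIGHTNESS `lintegral_cubicTail_time_zero_ge`: at `s = 0` under the homogeneous unit law the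
   functional is `≥ K³ e^{-(K+1)²/2}/√(2π)` for every `σ ≤ 1/2`, `N`, flow, `K ≥ 0` — the decay in the
   level is NO FASTER than the thermal Gaussian `e^{-K²/(2θ)}`; (c2) hence the GAUSSIAN-RATE family
   `{e^{-cK²} : c > 0}` in place of `{e^{-cK} : c > 0}` is FALSE flow-wise (`not_gaussianRate_homogeneous`)
   and as a crux text, UNCONDITIONALLY (`superGaussianEnergyTails_false`: flows exist, constant states
   are classical hs-Euler solutions, the constant-profile LLN holds — all landed); (c3) the LEVEL MUST
   GROW WITH THE RATE (§3 here): at equilibrium the bound at rate `c ≥ 3` FAILS at level `K = c`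
   (`seet_fails_at_level_eq_rate`), so `K₀(c) > c` (`2cθ` in general) — the quantifier order
   `∀ c ∃ K₀` cannot be improved to `∃ K₀ ∀ c` (`not_uniformLevel`: that strengthening says "eventually
   no sphere faster than `K₀`", false by the Gaussian tail); (c4) the EXPONENTIAL-MOMENT (window-LD /
   entropy-inequality) currency is dead for this functional exactly as for ECT
   (`EnergyCurrentTailsNegative.energyCurrentTailsExpMoment_false`, catalogued
   `HighMomentumCutoffBarrierNarrow` conjunct (2)): `E_{λ_N} exp(β ∑ᵢ tailᵢ) = ∞` at `t = 0` for all
   `β > 0` — SEET can only ever be consumed as an expectation bound with a rate, as the dock does.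
5. WHY IT RESISTS (substance): a counterexample needs the deterministic PRE-SHOCK dynamics from local
   Gibbs data to produce, uniformly in `N`, a one-body velocity tail at some time `s ≤ t` that is merely
   exponential (or fatter) in the level — e.g. a density `∝ e^{-a|v|}` of suprathermal spheres with
   non-vanishing mass, or energy `≳ K²` focused on a fraction `≳ e^{-cK}` of spheres for unboundedly many
   `K`.  Every kinetic description of the pre-shock regime predicts the opposite: GAUSSIAN upper bounds
   propagate for the hard-sphere Boltzmann equation (Gamba–Panferov–Villani 2009, upper Maxwellian
   bounds; Alonso–Cañizo–Gamba–Mouhot 2013, propagation of exponential moments of order `s ≤ 2`, creation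
   only of order `s = 1` — NB order-1 moments alone would NOT give SEET, cf. (c3)/(c1): the natural
   prover's target is propagation of a stretched-exponential moment of some order `s > 1`, the catalogued
   `HighMomentumCutoff` being `s = 2`); the compressible-Euler limit of Boltzmann by Hilbert/Chapman–Enskog
   expansion carries Gaussian-weighted remainders (Caflisch 1980; Guo–Jang–Jiang 2010); fast-sphere
   cascades in a cold hard-sphere gas SPREAD energy (Antal–Krapivsky–Redner 2008).  At the `N`-body level
   the only a priori tools (energy, momentum, Liouville, `H(f_s | g_N) ≤ CN`, `f_s ≤ K^{N+1} g_N`) are blind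
   to super-exponential rates (HighMomentumCutoffBarrier(Narrow); ECT Disproof §5's `o(N)`-entropy
   mixture kills even uniform integrability), so no PROOF is in sight either; Lanford-type Gaussian a
   priori bounds live only up to Lanford's time in the Boltzmann–Grad scaling, which is zero macroscopic
   time at fixed `σ`.  Verdict: open, expected TRUE; not refutable by any finite/junk/equilibrium model.
6. SEARCHES: `ledger negatives` (no entry for 17701; 13733's Newton-cradle relay concerns transfer
   clamps, not velocity tails); barrier catalogue — `HighMomentumCutoff(Narrow)` is the relevant entry
   (its open hypothesis IMPLIES SEET: `seet_of_highMomentumCutoff`); literature: see NOTES.md §lit of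
   the seat (queries on uniform-in-`N` velocity tails for deterministic hard spheres: nothing beyond
   equilibrium and the stochastic Kac model).

## Landed / published
* `…Theorems.SuperExponentialEnergyTails.Negative.GaussianRateFalse` — p144828 ACCEPTED (commit
  a6d705fdb969): `gaussianReal_Ioi_ge`, `stdGaussian_coord_gt_ge`, `localGibbsLaw_coordEvent`,
  `lintegral_cubicTail_time_zero_ge`, `exp_neg_sq_lt_lowerBound`, `not_gaussianRate_homogeneous`,
  `superGaussianEnergyTails_false` — importable now (imported here).
* Positive companion (evidence only, not a landing): `EquilibriumRung.lean` in this crux directory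
  (`seet_homogeneous`, `seet_body_homogeneous`, `seet_restricted_homogeneous`).

## Index
* §1 the functional; SEET ⇒ ECT and HMC ⇒ SEET (landed, re-exported as `example`s); §1b
  `seetConclusion_of_allExpMoments` (order-one exponential moments at ALL rates ⇒ SEET's conclusion).
* §2 `SEETSure`, `seet_false_without_randomness` (randomness is load-bearing).
* §3 level-versus-rate and Gaussian rates: pointers to the landed `Negative/GaussianRateFalse.lean` and the
  prepared `Negative/LevelVersusRate.lean` (v1: prose; v2 re-exports).
* §4 (prose) the equilibrium rung — see `EquilibriumRung.lean`.
* §5 (prose) next attacks / targets for the re-arm.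
-/

noncomputable section

open MeasureTheory Filter Set Topology
open scoped ENNReal

namespace Summit.AtomisticToContinuum.HydrodynamicLimit.Cruxes.SuperExponentialEnergyTails.Disproof

open Literature.MathematicalPhysics.KineticTheory Literature.Analysis.FluidPDE
open Summit.AtomisticToContinuum.HydrodynamicLimit.Theses.OneFlightGossipEngine
  (SuperExponentialEnergyTails EnergyCurrentTails)
open Summit.AtomisticToContinuum.HydrodynamicLimit.Theorems

/-! ## §1 The functional and the landed implications -/

/-- One-particle cubic tail `𝟙{K < |v|} |v|³` (the crux's summand; same as ECT's `tail3`). -/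
def tail3 (K : ℝ) (v : V3) : ℝ := Set.indicator {v : V3 | K < ‖v‖} (fun v => ‖v‖ ^ 3) v

/-- The crux's empirical cubic tail `(N+1)⁻¹ ∑ᵢ 𝟙{K < |vᵢ|} |vᵢ|³` (same as ECT's `cubicTail`). -/
def cubicTail (N : ℕ) (K : ℝ) (z : Config (N + 1) (Fin 3) T3) : ℝ :=
  ((N : ℝ) + 1)⁻¹ * ∑ i : Fin (N + 1), tail3 K (z i).2

/-- The crux integrand is `ofReal ∘ cubicTail` (unfolding). -/
theorem cubicTail_eq (N : ℕ) (K : ℝ) (z : Config (N + 1) (Fin 3) T3) :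
    cubicTail N K z = ((N : ℝ) + 1)⁻¹ * ∑ i : Fin (N + 1),
      Set.indicator {v : V3 | K < ‖v‖} (fun v => ‖v‖ ^ 3) (z i).2 := rfl

/-- This file's `cubicTail` is ECT's `cubicTail` (the two cruxes share the functional). -/
theorem cubicTail_eq_ect (N : ℕ) (K : ℝ) (z : Config (N + 1) (Fin 3) T3) :
    cubicTail N K z = EnergyCurrentTailsNegative.cubicTail N K z := rfl

/-- SEET is the registered stub signature of the dock line (typing audit, `Iff.rfl`). -/
example : SuperExponentialEnergyTails ↔ ClampedTransferDockCubicRate.SuperExponentialEnergyTails :=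
  Iff.rfl

/-- SEET ⇒ ECT (landed, `ClampedTransferDockSeet.seet_imp_energyCurrentTails`). -/
example : SuperExponentialEnergyTails → EnergyCurrentTails :=
  ClampedTransferDockSeet.seet_imp_energyCurrentTails

/-- The catalogued open hypothesis `HighMomentumCutoff σ` (`σ < 1/2`) ⇒ SEET (landed,
`ClampedTransferDockSeet.seet_of_highMomentumCutoff`): SEET is WEAKER than Nachtergaele–Yau's II.1. -/
example : (∀ σ : ℝ, 0 < σ → σ < 1 / 2 → Literature.Barriers.AtomisticToContinuum.HighMomentumCutoff σ) →
    SuperExponentialEnergyTails :=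
  ClampedTransferDockSeet.seet_of_highMomentumCutoff

/-! ## §1b Reformulation for provers: SEET = "every order-one exponential velocity moment is bounded
uniformly in `N` and `s ≤ t`"

One direction, typed and proved here (the useful one): uniform bounds on `E (N+1)⁻¹ ∑ᵢ exp(a|vᵢ(s)|)` for
EVERY `a > 0` give the SEET conclusion with no `N₀` and no slack (`seetConclusion_of_allExpMoments`).  The
converse holds on paper by the layer-cake formula.  NB a bound at ONE rate `a` is NOT enough: a one-body
tail `∝ e^{-a|v|}` has `tail_K ≍ K³ e^{-aK}`, which is not `≤ e^{-cK}` for `c > a` — Boltzmann-type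
CREATION of order-one exponential moments (hard spheres create order `s = 1` only) cannot prove SEET;
PROPAGATION of the initial Gaussian (order `s = 2`, the catalogued `HighMomentumCutoff`) or of any
stretched-exponential moment of order `s > 1`, or of order-one moments at ALL rates, would. -/

/-- Pointwise: for `a > 0`, `‖v‖³ 1{‖v‖ > K} ≤ (48/a³) e^{-(a/2)K} e^{a‖v‖}` for every level `K`
(from `x³/6 ≤ eˣ` at `x = (a/2)‖v‖`). [folklore] -/
theorem indicator_cube_le_expMoment {a : ℝ} (ha : 0 < a) (K : ℝ) (v : V3) :
    Set.indicator {w : V3 | K < ‖w‖} (fun w => ‖w‖ ^ 3) v ≤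
      48 / a ^ 3 * Real.exp (-(a / 2 * K)) * Real.exp (a * ‖v‖) := by
  by_cases hv : K < ‖v‖
  · rw [Set.indicator_of_mem (show v ∈ {w : V3 | K < ‖w‖} from hv)]
    have hx : (a / 2 * ‖v‖) ^ 3 / 6 ≤ Real.exp (a / 2 * ‖v‖) := by
      have h := Real.pow_div_factorial_le_exp (x := a / 2 * ‖v‖) (by positivity) 3
      simpa [Nat.factorial] using h
    have ha3 : 0 < a ^ 3 := by positivity
    have hcube : ‖v‖ ^ 3 ≤ 48 / a ^ 3 * Real.exp (a / 2 * ‖v‖) := by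
      rw [div_mul_eq_mul_div, le_div_iff₀ ha3]
      have : (a / 2 * ‖v‖) ^ 3 / 6 = a ^ 3 * ‖v‖ ^ 3 / 48 := by ring
      rw [this] at hx
      linarith
    have hsplit : Real.exp (a / 2 * ‖v‖) ≤ Real.exp (-(a / 2 * K)) * Real.exp (a * ‖v‖) := by
      rw [← Real.exp_add]
      exact Real.exp_le_exp.2 (by nlinarith)
    calc ‖v‖ ^ 3 ≤ 48 / a ^ 3 * Real.exp (a / 2 * ‖v‖) := hcube
      _ ≤ 48 / a ^ 3 * (Real.exp (-(a / 2 * K)) * Real.exp (a * ‖v‖)) :=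
          mul_le_mul_of_nonneg_left hsplit (by positivity)
      _ = 48 / a ^ 3 * Real.exp (-(a / 2 * K)) * Real.exp (a * ‖v‖) := (mul_assoc _ _ _).symm
  · rw [Set.indicator_of_notMem (show v ∉ {w : V3 | K < ‖w‖} from hv)]
    positivity

/-- **Order-one exponential velocity moments at ALL rates, bounded uniformly in `N` and `s ≤ t`, give the
SEET conclusion** (no `N₀`, no slack): for laws `P N` and maps `F N s` on `(N+1)`-sphere phase space, if
for every `a > 0` there is `C < ∞` with `∫ (N+1)⁻¹ ∑ᵢ exp(a ‖vᵢ(F N s z)‖) dP_N ≤ C` for all `N` and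
`s ∈ [0, t]`, then for every rate `c > 0` there is `K₀ > 0` with
`∫ (N+1)⁻¹ ∑ᵢ ‖vᵢ‖³ 1{‖vᵢ‖ > K} (F N s z) dP_N ≤ e^{-cK}` for all `K ≥ K₀`, `N`, `s ∈ [0, t]`
(take `a = 2(c+1)`, `K₀ = max 1 ((48/a³) C)`). [folklore] -/
theorem seetConclusion_of_allExpMoments
    (P : (N : ℕ) → Measure (Config (N + 1) (Fin 3) T3))
    (F : (N : ℕ) → ℝ → Config (N + 1) (Fin 3) T3 → Config (N + 1) (Fin 3) T3) (t : ℝ)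
    (h : ∀ a : ℝ, 0 < a → ∃ C : ℝ≥0∞, C < ∞ ∧ ∀ N : ℕ, ∀ s ∈ Set.Icc 0 t,
      ∫⁻ z, ENNReal.ofReal (((N : ℝ) + 1)⁻¹ * ∑ i : Fin (N + 1), Real.exp (a * ‖(F N s z i).2‖)) ∂(P N)
        ≤ C) :
    ∀ c : ℝ, 0 < c → ∃ K₀ : ℝ, 0 < K₀ ∧ ∀ K : ℝ, K₀ ≤ K → ∀ N : ℕ, ∀ s ∈ Set.Icc 0 t,
      ∫⁻ z, ENNReal.ofReal (((N : ℝ) + 1)⁻¹ * ∑ i : Fin (N + 1),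
          Set.indicator {v : V3 | K < ‖v‖} (fun v => ‖v‖ ^ 3) ((F N s z i).2)) ∂(P N) ≤
        ENNReal.ofReal (Real.exp (-(c * K))) := by
  intro c hc
  set a : ℝ := 2 * (c + 1) with ha_def
  have ha : 0 < a := by positivity
  obtain ⟨C, hC, hb⟩ := h a ha
  set B : ℝ := 48 / a ^ 3 with hB_def
  have hB : 0 < B := by positivity
  refine ⟨max 1 (B * C.toReal), lt_of_lt_of_le one_pos (le_max_left _ _), fun K hK N s hs => ?_⟩
  have hK1 : 1 ≤ K := (le_max_left _ _).trans hK
  have hKBC : B * C.toReal ≤ K := (le_max_right _ _).trans hK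
  -- pointwise domination of the integrand
  have hpt : ∀ z : Config (N + 1) (Fin 3) T3,
      ENNReal.ofReal (((N : ℝ) + 1)⁻¹ * ∑ i : Fin (N + 1),
        Set.indicator {v : V3 | K < ‖v‖} (fun v => ‖v‖ ^ 3) ((F N s z i).2)) ≤
      ENNReal.ofReal (B * Real.exp (-(a / 2 * K))) *
        ENNReal.ofReal (((N : ℝ) + 1)⁻¹ * ∑ i : Fin (N + 1), Real.exp (a * ‖(F N s z i).2‖)) := by
    intro z
    rw [← ENNReal.ofReal_mul (by positivity)]
    refine ENNReal.ofReal_le_ofReal ?_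
    calc ((N : ℝ) + 1)⁻¹ * ∑ i : Fin (N + 1),
          Set.indicator {v : V3 | K < ‖v‖} (fun v => ‖v‖ ^ 3) ((F N s z i).2)
        ≤ ((N : ℝ) + 1)⁻¹ * ∑ i : Fin (N + 1),
            B * Real.exp (-(a / 2 * K)) * Real.exp (a * ‖(F N s z i).2‖) :=
          mul_le_mul_of_nonneg_left
            (Finset.sum_le_sum fun i _ => indicator_cube_le_expMoment ha K _) (by positivity)
      _ = B * Real.exp (-(a / 2 * K)) *
            (((N : ℝ) + 1)⁻¹ * ∑ i : Fin (N + 1), Real.exp (a * ‖(F N s z i).2‖)) := by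
          rw [← Finset.mul_sum]; ring
  -- the rate bookkeeping: `B e^{-(a/2)K} C ≤ e^{-cK}` since `(a/2)K = (c+1)K` and `B C ≤ K ≤ e^K`
  have hrate : B * Real.exp (-(a / 2 * K)) * C.toReal ≤ Real.exp (-(c * K)) := by
    have h1 : a / 2 * K = c * K + K := by rw [ha_def]; ring
    have h2 : B * C.toReal ≤ Real.exp K := hKBC.trans (by linarith [Real.add_one_le_exp K])
    calc B * Real.exp (-(a / 2 * K)) * C.toReal
        = Real.exp (-(c * K)) * (Real.exp (-K) * (B * C.toReal)) := by
          rw [h1, neg_add, Real.exp_add]; ring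
      _ ≤ Real.exp (-(c * K)) * (Real.exp (-K) * Real.exp K) :=
          mul_le_mul_of_nonneg_left (mul_le_mul_of_nonneg_left h2 (Real.exp_pos _).le)
            (Real.exp_pos _).le
      _ = Real.exp (-(c * K)) := by rw [← Real.exp_add, neg_add_cancel, Real.exp_zero, mul_one]
  calc ∫⁻ z, ENNReal.ofReal (((N : ℝ) + 1)⁻¹ * ∑ i : Fin (N + 1),
          Set.indicator {v : V3 | K < ‖v‖} (fun v => ‖v‖ ^ 3) ((F N s z i).2)) ∂(P N)
      ≤ ∫⁻ z, ENNReal.ofReal (B * Real.exp (-(a / 2 * K))) *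
          ENNReal.ofReal (((N : ℝ) + 1)⁻¹ * ∑ i : Fin (N + 1), Real.exp (a * ‖(F N s z i).2‖)) ∂(P N) :=
        lintegral_mono (hpt ·)
    _ = ENNReal.ofReal (B * Real.exp (-(a / 2 * K))) *
          ∫⁻ z, ENNReal.ofReal (((N : ℝ) + 1)⁻¹ * ∑ i : Fin (N + 1), Real.exp (a * ‖(F N s z i).2‖)) ∂(P N) :=
        lintegral_const_mul' _ _ ENNReal.ofReal_ne_top
    _ ≤ ENNReal.ofReal (B * Real.exp (-(a / 2 * K))) * C := mul_le_mul' le_rfl (hb N s hs)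
    _ = ENNReal.ofReal (B * Real.exp (-(a / 2 * K))) * ENNReal.ofReal C.toReal := by
        rw [ENNReal.ofReal_toReal hC.ne]
    _ = ENNReal.ofReal (B * Real.exp (-(a / 2 * K)) * C.toReal) :=
        (ENNReal.ofReal_mul (by positivity)).symm
    _ ≤ ENNReal.ofReal (Real.exp (-(c * K))) := ENNReal.ofReal_le_ofReal hrate

/-! ## §2 Load-bearing: the randomness of the data

The SURE version of SEET over configurations of bounded energy per particle is false — energy
conservation alone is blind to the cubic tail (one sphere may carry energy `N + 1`).  Derived from the
sibling crux's `EnergyCurrentTailsSure` (ECT negative knowledge 2/3). -/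

/-- The sure (pathwise) version of SEET: for configurations of kinetic energy `≤ E₀` per particle the
empirical cubic tail above level `K ≥ K₀(c)` is `≤ e^{-cK} + ε` for `N ≥ N₀`, surely. [folklore] -/
def SEETSure : Prop :=
  ∀ E₀ : ℝ, 0 < E₀ → ∀ c : ℝ, 0 < c → ∃ K₀ : ℝ, 0 < K₀ ∧ ∀ K : ℝ, K₀ ≤ K → ∀ ε : ℝ, 0 < ε →
    ∃ N₀ : ℕ, ∀ N : ℕ, N₀ ≤ N → ∀ z : Config (N + 1) (Fin 3) T3,
      ((N : ℝ) + 1)⁻¹ * ∑ i : Fin (N + 1), ‖(z i).2‖ ^ 2 ≤ E₀ → cubicTail N K z ≤ Real.exp (-(c * K)) + ε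

/-- The sure version of SEET implies the sure version of ECT (rate `1`, a level with `e^{-K} ≤ ε/2`,
slack `ε/2`). -/
theorem ectSure_of_seetSure (h : SEETSure) : EnergyCurrentTailsNegative.EnergyCurrentTailsSure := by
  intro E₀ hE₀ ε hε
  obtain ⟨K₀, -, hK⟩ := h E₀ hE₀ 1 one_pos
  obtain ⟨K, hK₀K, hexpK⟩ := ClampedTransferDockSeet.exists_level_exp_le K₀ ε hε
  obtain ⟨N₀, hN⟩ := hK K hK₀K (ε / 2) (by positivity)
  refine ⟨K, N₀, fun N hNN z hz => ?_⟩
  have key := hN N hNN z hz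
  rw [cubicTail_eq_ect] at key
  have h1 : Real.exp (-(1 * K)) = Real.exp (-K) := by rw [one_mul]
  rw [h1] at key
  linarith

/-- **Any proof of SEET must use the randomness of the data**: the sure version is false (witness
of ECT's `energyCurrentTails_false_without_randomness`: one sphere of speed `√(N+1)`, energy `1` per
particle, cubic tail `√(N+1)`). -/
theorem seet_false_without_randomness : ¬ SEETSure := fun h =>
  EnergyCurrentTailsNegative.energyCurrentTails_false_without_randomness (ectSure_of_seetSure h)

/-! ## §3 Level versus rate; Gaussian rates (LANDED / prepared — prose pointers in this v1)

All at GLOBAL EQUILIBRIUM (homogeneous unit profile), `σ ≤ 1/2`, time `s = 0`, EVERY flow family: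
* LANDED `Theorems/SuperExponentialEnergyTails/Negative/GaussianRateFalse.lean` (p144828):
  `lintegral_cubicTail_time_zero_ge` (TIGHTNESS `E tail_K(0) ≥ K³ e^{-(K+1)²/2}/√(2π)`),
  `not_gaussianRate_homogeneous` (the family `{e^{-cK²}}` fails flow-wise),
  `superGaussianEnergyTails_false` (the Gaussian-rate crux text is false, unconditionally).
* PREPARED (seat folder `neg/LevelVersusRate.lean`, to land as `…/Negative/LevelVersusRate.lean` once the
  farm has built negative knowledge 1): `exp_rate_lt_lowerBound` (`3 ≤ K ≤ c ⇒ e^{-cK} < K³e^{-(K+1)²/2}/√(2π)`),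
  `seet_fails_at_level_eq_rate` (at rate `c ≥ 3` the SEET bound FAILS at level `K = c`, so `K₀(c) > c`),
  `not_uniformLevel` (`∃ K₀ ∀ c` is false flow-wise), `uniformLevelEnergyTails_false` (and as a crux text,
  unconditionally).  This v1 of the workfile does not import negative knowledge 1 only because the farm
  snapshot had not yet built it; v2 re-exports both files as `example`s. -/

/-- Re-export: the exponential-moment (LD) currency is dead for the functional, at `t = 0`, under every
local Gibbs law (ECT negative knowledge 1/2, `energyCurrentTailsExpMoment_false`) — SEET shares the
functional, so it too can only be consumed as an expectation bound with a rate. -/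
example : ¬ EnergyCurrentTailsNegative.EnergyCurrentTailsExpMoment :=
  EnergyCurrentTailsNegative.energyCurrentTailsExpMoment_false

/-! ## §4 The equilibrium rung (prose; checked in `EquilibriumRung.lean` of this directory)

`Equilibrium.seet_homogeneous`: for `(a₀, u₀, θ₀) = (1, 0, θ̄)`, `0 < σ < 1/2`, every flow family and
rate `c`, `E tail_K(s) ≤ e^{-cK}` for `K ≥ K₀(c, θ̄)`, all `N`, all `s ∈ ℝ`; `seet_body_homogeneous`: the
crux body verbatim at that profile (`σ₀ = 1/2`, `N₀ = 0`).  Method: `HardSphereFlow.flow_eq_ae_holds` +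
`AprioriBoundsNegative.measurePreserving_regFlow_localGibbsMeasure` + `seet_time_zero`.  Evidence-only
(positive); general constant profiles `(a, u₀, θ̄)` follow the same way through
`localGibbsMeasure_const_activity` and the Galilean boost `localGibbsLaw_const_map_velShift` (not typed).

## §5 Next attacks / targets for the re-arm (prose)

* When a line is PICKED for this crux, attack its stubs first (payload `targets`); expected soft spots:
  any stub asserting a Gaussian moment at a PRESCRIBED rate (false beyond `1/(2 sup θ)`, cf. (c1)), any
  stub with the level chosen before the rate (cf. `not_uniformLevel`), any stub in exponential-moment /
  window-LD currency for a cubic functional (cf. (c4)), any "order-1 exponential moment ⇒ SEET" step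
  (insufficient: `e^{-a|v|}` tails have `tail_K ≍ K³e^{-aK}`, not `≤ e^{-cK}` for `c > a`).
* Non-equilibrium witness families worth a `kit compute` toy if a mechanism is ever proposed: hot slab in
  a cold gas (tails governed by `θ_max`, still Gaussian — no), converging (imploding) velocity data are
  post-shock — excluded by `t < T`; bullet cascades spread energy (AKR 2008) — no.  None promising: the
  adversary's honest report is that SEET is expected to be TRUE and is conjecture-grade only because no
  `N`-uniform dynamical tail estimate exists for deterministic hard spheres at fixed density.
-/

end Summit.AtomisticToContinuum.HydrodynamicLimit.Cruxes.SuperExponentialEnergyTails.Disproof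

end
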